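import Summits.RiemannHypothesis.RiemannHypothesis.Theorems.JensenLogBandArcDen2Sharp
import Summits.RiemannHypothesis.RiemannHypothesis.Theorems.JensenLogBandArcWindowDeriv
import HarnessLib

/-!
# The second derivative of the descent density on the window (BAND line, S4b — `q″ = O(n)`)

RH ladder column JENSEN, rung J-P(P3) «log band», BAND crux `XiDerivBandRealAllRates` of route
«JensenLogBand», line «band-one-window» (u-arc reshape), lead rh-jensen-prover g7 — steps (a)–(c)
of the S4b recipe in HOME/rh-jensen-prover/g7-work/LINE-PLAN.md §8.4–8.5. RH-FREE (Γ-factor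
only). WHAT THIS IS NOT: nothing here bears on zeros of `ζ` or the truth of RH.

Along the arc `u(θ) = c + r e^{iθ}` the log-derivative density of the `ζ`-free integrand is
`q(θ) = i(u−c)·S_{n,c}(u)`. On the part of the arc inside the `(3/5)h`-disc:
* `hasDerivAt_arcSaddleFn_eq`: `S′(u) = D′(u) + n/(u−c)²` with the CLOSED FORM `D′ = saddleDen1`;
* `hasDerivAt_descentDensity_eq`: `q′(θ) = −(u−c)·D(u) − (u−c)²·D′(u)` (the `n`'s cancel!);
* `hasDerivAt_descentDensity1`: `q″(θ) = −i·[(u−c)D + 3(u−c)²D′ + (u−c)³D″]`;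
* `norm_descentDensity2_le`: `‖q″(θ)‖ ≤ 4·n` there (`r = |u*−c| ≤ (10/9)h`; Den bounds p487106,
  `‖D′‖` p488229, sharp `‖D″‖` p492312).
The cubic window remainder `‖∫₀^ψ q − ½q′(φ₀)ψ²‖ ≤ 4n|ψ|³` follows by two integrations (next file).
-/

noncomputable section

-- single-problem summit: `Summit.RiemannHypothesis.RiemannHypothesis.…` is the tree convention
set_option linter.dupNamespace false

open Complex Real Set

namespace Summit.RiemannHypothesis.RiemannHypothesis.Theorems.JensenPolynomials.LogBandArc

open Literature.NumberTheory.LFunctions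

variable {n : ℕ} {x T : ℝ} {u : ℂ}

/-- **`S′ = D′ + n/(u−c)²` with `D′` in closed form**, on the disc. [folklore] -/
theorem hasDerivAt_arcSaddleFn_eq (hx : |x| ≤ 1 / 2) (hT : 100 ≤ T)
    (hh : 1 / 2 ≤ bandRadius n T) (hhT : bandRadius n T ≤ 7 / 20 * T)
    (hu : ‖u - ((x : ℂ) + (T : ℂ) * I + bandRadius n T)‖ ≤ 3 / 5 * bandRadius n T) :
    HasDerivAt (arcSaddleFn n ((x : ℂ) + (T : ℂ) * I))
      (saddleDen1 n ((x : ℂ) + (T : ℂ) * I) u + (n : ℂ) / (u - ((x : ℂ) + (T : ℂ) * I)) ^ 2) u := by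
  set h := bandRadius n T with hhdef
  set c : ℂ := (x : ℂ) + (T : ℂ) * I with hc
  obtain ⟨him_lo, -, -, -, -, -, hnu_lo, hucim, -, -⟩ := disc_geometry hx hT hh hhT hu
  have hT0 : 0 < T := by linarith
  have him0 : 0 < (1 / 2 + u).im := by linarith
  have hu0 : u ≠ 0 := by intro h0; rw [h0, norm_zero] at hnu_lo; linarith
  have hupc : u + c ≠ 0 := by
    intro h0; have := congrArg Complex.im h0; rw [Complex.zero_im] at this
    have h' : 179 / 100 * T ≤ (u + c).im := hucim
    linarith
  have hD := hasDerivAt_saddleDen_eq n c him0 hu0 hupc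
  obtain ⟨him, hre⟩ := disc_coords hu
  have him' := abs_le.1 him
  have hre' := abs_le.1 hre
  have hx' := abs_le.1 hx
  have huc : u - c ≠ 0 := by
    intro h0
    have : (u - c).re = 0 := by rw [h0]; simp
    simp [hc] at this
    linarith
  have hderiv_frac : HasDerivAt (fun w : ℂ => (n : ℂ) / (w - c)) (-((n : ℂ) / (u - c) ^ 2)) u := by
    have h1 : HasDerivAt (fun w : ℂ => (w - c)⁻¹) (-1 / (u - c) ^ 2) u := by
      have := ((hasDerivAt_id u).sub_const c).fun_inv huc
      simpa using this
    have h2 := h1.const_mul (n : ℂ)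
    refine h2.congr_deriv ?_ |>.congr_of_eventuallyEq ?_
    · field_simp
    · exact Filter.Eventually.of_forall fun w => by simp [div_eq_mul_inv]
  have hmain := hD.sub hderiv_frac
  have hmain' : HasDerivAt (fun w : ℂ => saddleDen n c w - (n : ℂ) / (w - c))
      (saddleDen1 n c u + (n : ℂ) / (u - c) ^ 2) u := hmain.congr_deriv (by ring)
  refine hmain'.congr_of_eventuallyEq ?_
  have hre_u : 0 < (1 / 2 + u).re := by simp; linarith
  have hopen : ∀ᶠ w in nhds u, 0 < (1 / 2 + w).re ∧ 1 / 2 + w ≠ 1 := by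
    have h1 : ∀ᶠ w in nhds u, 0 < (1 / 2 + w).re :=
      (Complex.continuous_re.comp (continuous_const.add continuous_id)).continuousAt.eventually
        (isOpen_Ioi.mem_nhds hre_u)
    have hne : (1 / 2 + u).im ≠ (1 : ℂ).im := by
      simp; intro h0; rw [h0] at him'; linarith
    have h2 : ∀ᶠ w in nhds u, 1 / 2 + w ≠ 1 := by
      have hc2 : ContinuousAt (fun w : ℂ => (1 / 2 + w).im) u :=
        (Complex.continuous_im.comp (continuous_const.add continuous_id)).continuousAt
      have := hc2.eventually (isOpen_ne.mem_nhds hne)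
      filter_upwards [this] with w hw h0
      exact hw (by rw [h0])
    exact h1.and h2
  filter_upwards [hopen] with w hw
  exact arcSaddleFn_eq_saddleDen_sub n c hw.1 hw.2

/-- The descent density and its first derivative in closed form along the arc `c + r e^{iθ}`. -/
def descentDensity (n : ℕ) (c : ℂ) (r θ : ℝ) : ℂ :=
  I * (circleMap c r θ - c) * arcSaddleFn n c (circleMap c r θ)

/-- `q′(θ) = −(u−c)·D(u) − (u−c)²·D′(u)`, `u = c + r e^{iθ}` (closed form). [folklore] -/
def descentDensity1 (n : ℕ) (c : ℂ) (r θ : ℝ) : ℂ :=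
  -(circleMap c r θ - c) * saddleDen n c (circleMap c r θ) -
    (circleMap c r θ - c) ^ 2 * saddleDen1 n c (circleMap c r θ)

/-- `q″(θ) = −i·[(u−c)D + 3(u−c)²D′ + (u−c)³D″]` (closed form). [folklore] -/
def descentDensity2 (n : ℕ) (c : ℂ) (r θ : ℝ) : ℂ :=
  -I * ((circleMap c r θ - c) * saddleDen n c (circleMap c r θ) +
    3 * (circleMap c r θ - c) ^ 2 * saddleDen1 n c (circleMap c r θ) +
    (circleMap c r θ - c) ^ 3 * saddleDen2 n c (circleMap c r θ))

/-- **`q′` in closed form (the `n`'s cancel):** on the part of the arc inside the disc,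
`HasDerivAt q (descentDensity1 n c r θ) θ`. [folklore] -/
theorem hasDerivAt_descentDensity_eq (hx : |x| ≤ 1 / 2) (hT : 100 ≤ T)
    (hh : 1 / 2 ≤ bandRadius n T) (hhT : bandRadius n T ≤ 7 / 20 * T) {r θ : ℝ}
    (hmem : ‖circleMap ((x : ℂ) + (T : ℂ) * I) r θ - ((x : ℂ) + (T : ℂ) * I + bandRadius n T)‖ ≤
      3 / 5 * bandRadius n T) :
    HasDerivAt (descentDensity n ((x : ℂ) + (T : ℂ) * I) r)
      (descentDensity1 n ((x : ℂ) + (T : ℂ) * I) r θ) θ := by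
  set c : ℂ := (x : ℂ) + (T : ℂ) * I with hc
  set u : ℂ := circleMap c r θ with hu
  have hS' := hasDerivAt_arcSaddleFn_eq hx hT hh hhT hmem
  obtain ⟨-, -, hre_lo, -, -, -, -, -⟩ := disc_geometry hx hT hh hhT hmem
  have hx' := abs_le.1 hx
  obtain ⟨him, -⟩ := disc_coords hmem
  have him' := abs_le.1 him
  have hre : 0 < (1 / 2 + u).re := by linarith
  have h1 : 1 / 2 + u ≠ 1 := by
    intro h0; have := congrArg Complex.im h0; simp at this
    have : u.im = 0 := by simpa using this
    rw [this] at him'; linarith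
  have huc : u - c ≠ 0 := by
    intro h0
    have hh0 : 0 < bandRadius n T := by linarith
    have : ‖u - (c + bandRadius n T)‖ = bandRadius n T := by
      rw [show u - (c + (bandRadius n T : ℂ)) = (u - c) - bandRadius n T by ring, h0, zero_sub,
        norm_neg, Complex.norm_real, Real.norm_eq_abs, abs_of_pos hh0]
    have hmem' : ‖u - (c + bandRadius n T)‖ ≤ 3 / 5 * bandRadius n T := hmem
    linarith
  have hSeq : arcSaddleFn n c u = saddleDen n c u - n / (u - c) := arcSaddleFn_eq_saddleDen_sub n c hre h1
  -- product rule along the arc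
  have hcm : HasDerivAt (fun t : ℝ => circleMap c r t - c) (circleMap 0 r θ * I) θ :=
    (hasDerivAt_circleMap c r θ).sub_const c
  have hS : HasDerivAt (fun t : ℝ => arcSaddleFn n c (circleMap c r t))
      ((saddleDen1 n c u + (n : ℂ) / (u - c) ^ 2) * (circleMap 0 r θ * I)) θ := by
    have hD'2 : HasDerivAt (arcSaddleFn n c) (saddleDen1 n c u + (n : ℂ) / (u - c) ^ 2)
        (circleMap c r θ) := hS'
    exact HasDerivAt.comp θ hD'2 (hasDerivAt_circleMap c r θ)
  have hprod := ((hcm.const_mul I).mul hS)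
  have e0 : circleMap 0 r θ = u - c := by rw [hu, circleMap_sub_center]
  refine (hprod.congr_of_eventuallyEq (Filter.Eventually.of_forall fun t => rfl)).congr_deriv ?_
  rw [e0, descentDensity1, ← hu, hSeq]
  field_simp
  ring_nf
  rw [Complex.I_sq]
  ring

/-- **`q″` in closed form:** on the part of the arc inside the disc,
`HasDerivAt q′ (descentDensity2 n c r θ) θ`. [folklore] -/
theorem hasDerivAt_descentDensity1 (hx : |x| ≤ 1 / 2) (hT : 100 ≤ T)
    (hh : 1 / 2 ≤ bandRadius n T) (hhT : bandRadius n T ≤ 7 / 20 * T) {r θ : ℝ}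
    (hmem : ‖circleMap ((x : ℂ) + (T : ℂ) * I) r θ - ((x : ℂ) + (T : ℂ) * I + bandRadius n T)‖ ≤
      3 / 5 * bandRadius n T) :
    HasDerivAt (descentDensity1 n ((x : ℂ) + (T : ℂ) * I) r)
      (descentDensity2 n ((x : ℂ) + (T : ℂ) * I) r θ) θ := by
  set c : ℂ := (x : ℂ) + (T : ℂ) * I with hc
  set u : ℂ := circleMap c r θ with hu
  obtain ⟨him_lo, -, -, -, -, -, hnu_lo, hucim, -, -⟩ := disc_geometry hx hT hh hhT hmem
  have hT0 : 0 < T := by linarith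
  have him0 : 0 < (1 / 2 + u).im := by linarith
  have hu0 : u ≠ 0 := by
    intro h0
    have h' : 79 / 100 * T ≤ ‖u‖ := hnu_lo
    rw [h0, norm_zero] at h'; linarith
  have hupc : u + c ≠ 0 := by
    intro h0; have := congrArg Complex.im h0; rw [Complex.zero_im] at this
    have h' : 179 / 100 * T ≤ (u + c).im := hucim
    linarith
  have hD : HasDerivAt (fun w : ℂ => saddleDen n c w) (saddleDen1 n c u) u :=
    hasDerivAt_saddleDen_eq n c him0 hu0 hupc
  have hD1 : HasDerivAt (fun w : ℂ => saddleDen1 n c w) (saddleDen2 n c u) u :=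
    hasDerivAt_saddleDen1 n c him0 hu0 hupc
  have hcm : HasDerivAt (fun t : ℝ => circleMap c r t - c) (circleMap 0 r θ * I) θ :=
    (hasDerivAt_circleMap c r θ).sub_const c
  have hDarc : HasDerivAt (fun t : ℝ => saddleDen n c (circleMap c r t))
      (saddleDen1 n c u * (circleMap 0 r θ * I)) θ := by
    have hD2 : HasDerivAt (fun w : ℂ => saddleDen n c w) (saddleDen1 n c u) (circleMap c r θ) := hD
    exact HasDerivAt.comp θ hD2 (hasDerivAt_circleMap c r θ)
  have hD1arc : HasDerivAt (fun t : ℝ => saddleDen1 n c (circleMap c r t))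
      (saddleDen2 n c u * (circleMap 0 r θ * I)) θ := by
    have hD2 : HasDerivAt (fun w : ℂ => saddleDen1 n c w) (saddleDen2 n c u) (circleMap c r θ) := hD1
    exact HasDerivAt.comp θ hD2 (hasDerivAt_circleMap c r θ)
  have hterm1 := (hcm.neg.mul hDarc)
  have hterm2 := ((hcm.pow 2).mul hD1arc)
  have hall := hterm1.sub hterm2
  have e0 : circleMap 0 r θ = u - c := by rw [hu, circleMap_sub_center]
  refine (hall.congr_of_eventuallyEq (Filter.Eventually.of_forall fun t => by
    simp [descentDensity1])).congr_deriv ?_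
  simp only [Pi.neg_apply, Pi.pow_apply]
  rw [e0, descentDensity2]
  simp only [← hu]
  push_cast
  ring

/-- **`‖q″‖ ≤ 4n` on the window:** at a point of the arc `c + r e^{iθ}` inside the `(3/5)h`-disc,
with `0 ≤ r ≤ (10/9)h` (the saddle radius, `arcSaddle_polar_bounds`), `ℓ_T ≥ 20`, `n ≥ 100`:
`‖descentDensity2 n c r θ‖ ≤ 4n`. [folklore] -/
theorem norm_descentDensity2_le (hx : |x| ≤ 1 / 2) (hT : 100 ≤ T) (hℓ : 20 ≤ ell T) (hn : 100 ≤ n)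
    (hh : 1 / 2 ≤ bandRadius n T) (hhT : bandRadius n T ≤ 7 / 20 * T) {r θ : ℝ} (hr0 : 0 ≤ r)
    (hr : r ≤ 10 / 9 * bandRadius n T)
    (hmem : ‖circleMap ((x : ℂ) + (T : ℂ) * I) r θ - ((x : ℂ) + (T : ℂ) * I + bandRadius n T)‖ ≤
      3 / 5 * bandRadius n T) :
    ‖descentDensity2 n ((x : ℂ) + (T : ℂ) * I) r θ‖ ≤ 4 * n := by
  set h := bandRadius n T with hhdef
  set ℓ := ell T with hℓdef
  set c : ℂ := (x : ℂ) + (T : ℂ) * I with hc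
  set u : ℂ := circleMap c r θ with hu
  have hT0 : 0 < T := by linarith
  have hh0 : 0 < h := by linarith
  have hhℓ : h * ℓ = 2 * ((n : ℝ) + 1) := bandRadius_mul_ell hℓ
  have hn' : (100 : ℝ) ≤ n := by exact_mod_cast hn
  obtain ⟨him_lo, -, -, -, -, -, hnu_lo, hucim, -, -⟩ := disc_geometry hx hT hh hhT hmem
  have him0 : 0 < (1 / 2 + u).im := by linarith
  have hu0 : u ≠ 0 := by
    intro h0
    have h' : 79 / 100 * T ≤ ‖u‖ := hnu_lo
    rw [h0, norm_zero] at h'; linarith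
  have hupc : u + c ≠ 0 := by
    intro h0; have := congrArg Complex.im h0; rw [Complex.zero_im] at this
    have h' : 179 / 100 * T ≤ (u + c).im := hucim
    linarith
  -- (a) ‖D‖ ≤ 0.66 ℓ + 0.9
  obtain ⟨hR_lo, hR_hi, hJ_lo, hJ_hi⟩ := saddleDen_re_im_bounds hx hT hℓ hh hhT hmem
  have hD : ‖saddleDen n c u‖ ≤ 33 / 50 * ℓ + 9 / 10 := by
    have := Complex.norm_le_abs_re_add_abs_im (saddleDen n c u)
    have h1 : |(saddleDen n c u).re| ≤ 14 / 25 * ℓ := abs_le.2 ⟨by linarith, hR_hi⟩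
    have h2 : |(saddleDen n c u).im| ≤ 9 / 10 + ℓ / 10 := abs_le.2 ⟨by linarith, hJ_hi⟩
    linarith
  -- (b) ‖D′‖ via uniqueness of the derivative
  obtain ⟨D', hD', hb⟩ := hasDerivAt_saddleDen hx hT hℓ hn hh hhT hmem
  have hD1eq : saddleDen1 n c u = D' :=
    (hasDerivAt_saddleDen_eq n c him0 hu0 hupc).unique hD'
  -- (c) ‖D″‖ sharp
  have hure : 0 ≤ (u - c).re := by
    obtain ⟨-, hre⟩ := disc_coords hmem
    have := abs_le.1 hre
    simp [hc]
    have hx' := abs_le.1 hx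
    have : (u - c).re = u.re - x := by simp [hc]
    linarith
  have hur : ‖u - c‖ ≤ 6 / 5 * h := by
    rw [hu, circleMap_sub_center, norm_circleMap_zero, abs_of_nonneg hr0]; linarith
  have hD2 := norm_saddleDen2_le_sq hx hT hh hhT hure hur
  -- sizes along the arc: ‖u − c‖ = r
  have hnuc : ‖u - c‖ = r := by rw [hu, circleMap_sub_center, norm_circleMap_zero, abs_of_nonneg hr0]
  -- assemble
  have hq : ‖descentDensity2 n c r θ‖ ≤ r * ‖saddleDen n c u‖ + 3 * r ^ 2 * ‖saddleDen1 n c u‖ +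
      r ^ 3 * ‖saddleDen2 n c u‖ := by
    rw [descentDensity2, ← hu, norm_mul, norm_neg, Complex.norm_I, one_mul]
    have h3 := norm_add₃_le (a := (u - c) * saddleDen n c u) (b := 3 * (u - c) ^ 2 * saddleDen1 n c u)
      (c := (u - c) ^ 3 * saddleDen2 n c u)
    rw [norm_mul, norm_mul, norm_mul, norm_mul, norm_pow, norm_pow, hnuc, Complex.norm_ofNat] at h3
    exact h3
  -- numeric bounds with t = h/T ≤ 7/20, h ≤ (n+1)/10, r ≤ 10h/9
  set t := h / T with ht
  have hht : h = t * T := by rw [ht]; field_simp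
  have ht0 : 0 ≤ t := by positivity
  have ht1 : t ≤ 7 / 20 := by rw [ht, div_le_iff₀ hT0]; linarith
  have hh10 : h ≤ ((n : ℝ) + 1) / 10 := by
    have : 20 * h ≤ h * ℓ := by nlinarith only [hh0, hℓ]
    linarith
  have hr1 : r ≤ 10 / 9 * h := hr
  have hr2 : r ^ 2 ≤ (10 / 9 * h) ^ 2 := pow_le_pow_left₀ hr0 hr1 2
  have hr3 : r ^ 3 ≤ (10 / 9 * h) ^ 3 := pow_le_pow_left₀ hr0 hr1 3
  -- (a)
  have ka : r * ‖saddleDen n c u‖ ≤ 157 / 100 * ((n : ℝ) + 1) := by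
    calc r * ‖saddleDen n c u‖ ≤ (10 / 9 * h) * (33 / 50 * ℓ + 9 / 10) :=
          mul_le_mul hr1 hD (norm_nonneg _) (by positivity)
      _ = 10 / 9 * (33 / 50 * (h * ℓ) + 9 / 10 * h) := by ring
      _ ≤ 157 / 100 * ((n : ℝ) + 1) := by rw [hhℓ]; linarith
  -- (b)
  have kb : 3 * r ^ 2 * ‖saddleDen1 n c u‖ ≤ 123 / 100 * ((n : ℝ) + 1) := by
    rw [hD1eq]
    have hM0 : 0 ≤ 33 / 4 / T + 1 / (79 / 100 * T) ^ 2 + ((n : ℝ) + 1) / (179 / 100 * T) ^ 2 := by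
      positivity
    have k1 : 33 / 4 / T * (10 / 9 * h) ^ 2 ≤ 357 / 1000 * ((n : ℝ) + 1) := by
      have e1 : 33 / 4 / T * (10 / 9 * h) ^ 2 = 3300 / 324 * t * h := by
        rw [hht]; field_simp; ring
      rw [e1]
      have : t * h ≤ 7 / 20 * h := mul_le_mul_of_nonneg_right ht1 hh0.le
      linarith
    have k2 : 1 / (79 / 100 * T) ^ 2 * (10 / 9 * h) ^ 2 ≤ 25 / 10000 * ((n : ℝ) + 1) := by
      have e1 : 1 / (79 / 100 * T) ^ 2 * (10 / 9 * h) ^ 2 = 1000000 / 505521 * t ^ 2 := by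
        rw [hht]; field_simp; ring
      rw [e1]
      have : t ^ 2 ≤ (7 / 20) ^ 2 := pow_le_pow_left₀ ht0 ht1 2
      linarith
    have k3 : ((n : ℝ) + 1) / (179 / 100 * T) ^ 2 * (10 / 9 * h) ^ 2 ≤ 48 / 1000 * ((n : ℝ) + 1) := by
      have e1 : ((n : ℝ) + 1) / (179 / 100 * T) ^ 2 * (10 / 9 * h) ^ 2 =
          1000000 / 2595321 * t ^ 2 * ((n : ℝ) + 1) := by
        rw [hht]; field_simp; ring
      rw [e1]
      have ht2 : t ^ 2 ≤ (7 / 20) ^ 2 := pow_le_pow_left₀ ht0 ht1 2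
      have hn0 : (0 : ℝ) ≤ (n : ℝ) + 1 := by positivity
      have := mul_le_mul_of_nonneg_right ht2 hn0
      linarith
    calc 3 * r ^ 2 * ‖D'‖ ≤ 3 * (10 / 9 * h) ^ 2 *
          (33 / 4 / T + 1 / (79 / 100 * T) ^ 2 + ((n : ℝ) + 1) / (179 / 100 * T) ^ 2) := by
          have := mul_le_mul hr2 hb (norm_nonneg _) (by positivity)
          linarith
      _ = 3 * (33 / 4 / T * (10 / 9 * h) ^ 2 + 1 / (79 / 100 * T) ^ 2 * (10 / 9 * h) ^ 2 +
          ((n : ℝ) + 1) / (179 / 100 * T) ^ 2 * (10 / 9 * h) ^ 2) := by ring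
      _ ≤ 123 / 100 * ((n : ℝ) + 1) := by linarith
  -- (c)
  have kc : r ^ 3 * ‖saddleDen2 n c u‖ ≤ 67 / 100 * ((n : ℝ) + 1) := by
    have hM0 : 0 ≤ 25 / (2 * (29 / 50 * T) ^ 2) + 2 / (29 / 50 * T) ^ 3 +
        2 * ((n : ℝ) + 1) / (79 / 50 * T) ^ 3 := by positivity
    have k1 : (10 / 9 * h) ^ 3 * (25 / (2 * (29 / 50 * T) ^ 2)) ≤ 625 / 1000 * ((n : ℝ) + 1) := by
      have e1 : (10 / 9 * h) ^ 3 * (25 / (2 * (29 / 50 * T) ^ 2)) = 31250000 / 613089 * t ^ 2 * h := by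
        rw [hht]; field_simp; ring
      rw [e1]
      have ht2 : t ^ 2 ≤ (7 / 20) ^ 2 := pow_le_pow_left₀ ht0 ht1 2
      have := mul_le_mul_of_nonneg_right ht2 hh0.le
      linarith
    have k2 : (10 / 9 * h) ^ 3 * (2 / (29 / 50 * T) ^ 3) ≤ 1 / 100 * ((n : ℝ) + 1) := by
      have e1 : (10 / 9 * h) ^ 3 * (2 / (29 / 50 * T) ^ 3) = 250000000 / 17779581 * t ^ 3 := by
        rw [hht]; field_simp; ring
      rw [e1]
      have ht3 : t ^ 3 ≤ (7 / 20) ^ 3 := pow_le_pow_left₀ ht0 ht1 3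
      linarith
    have k3 : (10 / 9 * h) ^ 3 * (2 * ((n : ℝ) + 1) / (79 / 50 * T) ^ 3) ≤ 3 / 100 * ((n : ℝ) + 1) := by
      have e1 : (10 / 9 * h) ^ 3 * (2 * ((n : ℝ) + 1) / (79 / 50 * T) ^ 3) =
          250000000 / 359425431 * t ^ 3 * ((n : ℝ) + 1) := by
        rw [hht]; field_simp; ring
      rw [e1]
      have ht3 : t ^ 3 ≤ (7 / 20) ^ 3 := pow_le_pow_left₀ ht0 ht1 3
      have hn0 : (0 : ℝ) ≤ (n : ℝ) + 1 := by positivity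
      have := mul_le_mul_of_nonneg_right ht3 hn0
      linarith
    calc r ^ 3 * ‖saddleDen2 n c u‖ ≤ (10 / 9 * h) ^ 3 * (25 / (2 * (29 / 50 * T) ^ 2) +
          2 / (29 / 50 * T) ^ 3 + 2 * ((n : ℝ) + 1) / (79 / 50 * T) ^ 3) :=
          mul_le_mul hr3 hD2 (norm_nonneg _) (by positivity)
      _ = (10 / 9 * h) ^ 3 * (25 / (2 * (29 / 50 * T) ^ 2)) + (10 / 9 * h) ^ 3 * (2 / (29 / 50 * T) ^ 3) +
          (10 / 9 * h) ^ 3 * (2 * ((n : ℝ) + 1) / (79 / 50 * T) ^ 3) := by ring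
      _ ≤ 67 / 100 * ((n : ℝ) + 1) := by linarith
  linarith

end Summit.RiemannHypothesis.RiemannHypothesis.Theorems.JensenPolynomials.LogBandArc

end
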